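import Mathlib
import Summits.Ventures.PercRepro2.CoinChainTauLayer
import Summits.Ventures.PercRepro2.CoinChainWorld1
import Summits.Ventures.PercRepro2.CoinChainMixLsm
import Summits.Ventures.PercRepro2.CoinChainOneMarker
import Summits.Ventures.PercRepro2.CoinChainGenQprime
import Summits.Ventures.PercRepro2.CoinChainXACross

/-!
# Lemmas for (XA′) under sign conditions: the closed-gate bound for the world-0 gate, the nested
ideals, and the algebra of the τ-layer-cake proof (blind cell PercRepro2, night-2 g26;
proofs/NIGHT2-DARC.md §67)

Notation of `chain_functional_nonneg_of_XA'`: `R⁰ = ν·chainMix ent ent' 0 c d` (moments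
`a0, a1, a2`), `R¹ = ν·chainMix ent ent' 1 c d` (`b`), `G⁰ = ν·chainMix ent ent' 0 c d'` (`e`),
`G¹ = ν·chainMix ent ent' 1 c d'` (`g`).  The three SIGN CONDITIONS, all about the world-0-centred
`x`-shifts of the killed laws `Q = R⁰ − R¹` (coin-killed), `P⁰ = R⁰ − G⁰` (world-0 pivotal) and
`P′ = (R¹ − G¹) − P⁰` (the `D′`-pivotal part):

* `hQx`  : `a0 b1 ≤ a1 b0`  — `Q_x ≥ 0`, i.e. the coin LOWERS the `x`-mean (`ε ≤ 0`);
* `hP0x` : `a0 e1 ≤ a1 e0`  — `P⁰_x ≥ 0`, the world-0 gate lowers the `x`-mean (`σ⁰ ≤ 0`);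
* `hP'x` : `(a0 b1 − a1 b0) − (a0 g1 − a1 g0) + (a0 e1 − a1 e0) ≥ 0` — `P′_x ≥ 0`.

THEOREM (`chain_XA'_of_signs`): under them (XA′) holds, `Cross ≤ a0·U001`; hence
(`chain_functional_nonneg_of_signs`) the general chain at every `ρ ∈ [0, 1]`.  The `y`-versions
follow by the symmetry `x ↔ y` of all statements.

Proof (the τ-layer cake, §67).  By `tau_layer_bound` for the cross pair `(R⁰, G¹)` with entries
`ent ∪ ent'`: `(a2 m − a0 mʸ)·K ≤ m·U001` with `m, mʸ` the ideal mass and `y`-moment and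
`K = ∑ (R⁰ − G¹)(a0 x − a1) = Q_x + P′_x + P⁰_x` (cleared).  Then `K ≥ Q_x + P⁰_x` (`hP'x`), the
factor `a2 m − a0 mʸ ≥ 0` (the ideal is below the world-0 mean), and the two killed `y`-shifts are
bounded by it: `m·P⁰_y ≤ a0 (a2 m − a0 mʸ)` (the world-0 gate's excess on the entered clusters is
nonnegative and the nested ideals `I₀ ⊆ I_e` have increasing means) and
`m·Q_y ≤ a0 (a2 m − a0 mʸ)` (the closed-gate bound `chain_closed_om_zero`).  With `Q_x, P⁰_x ≥ 0`
this gives `m·a0·U001 ≥ m·(Q_x P⁰_y + Q_y P⁰_x) = m·Cross`.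
-/

namespace Summit.Ventures.PercRepro2.Coin

open Classical

section XASignsLemmas

variable {V : Type*} [DecidableEq V] {R : Type*} [Field R] [LinearOrder R] [IsStrictOrderedRing R]

omit [LinearOrder R] [IsStrictOrderedRing R] in
/-- Off `ent` the coin-closed mixture is `c`. -/
lemma chainMix_zero_of_not_meet_ent (ent ent' : Finset V) (c d : Finset V → R) {W : Finset V}
    (h : ¬ ∃ r ∈ ent, r ∈ W) : chainMix ent ent' 0 c d W = c W := by
  unfold chainMix chainTheta
  by_cases h1 : ∃ r ∈ ent', r ∈ W
  · simp [h, h1]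
  · simp [h, h1]

omit [LinearOrder R] [IsStrictOrderedRing R] in
/-- On the clusters meeting `ent` the coin-closed mixture is `d`. -/
lemma chainMix_zero_of_meet_ent (ent ent' : Finset V) (c d : Finset V → R) {W : Finset V}
    (h : ∃ r ∈ ent, r ∈ W) : chainMix ent ent' 0 c d W = d W := by
  unfold chainMix chainTheta
  simp [h]

/-- **The world-0 gate's excess on the clusters meeting `ent` is nonnegative**:
`(∑ R⁰ z)·(∑_{D_e} ν d') ≤ (∑ R⁰)·(∑_{D_e} ν d' z)` — `mean_le_tilt` through the global tilt
`ν d'` (the cross inequality `chain_cross_holley` at `ρ = 0`), then `tilt_upset_mean`. -/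
theorem chain_closed_gate_zero (U ent ent' : Finset V) (ν c d d' : Finset V → R)
    (hν0 : ∀ W, 0 ≤ ν W) (hν : ∀ s ⊆ U, ∀ t ⊆ U, ν s * ν t ≤ ν (s ∩ t) * ν (s ∪ t))
    (hc0 : ∀ W, 0 ≤ c W) (hd0 : ∀ W, 0 ≤ d W) (hd'0 : ∀ W, 0 ≤ d' W) (hdc : ∀ W, d W ≤ c W)
    (hd'd' : ∀ s t, d' s * d' t ≤ d' (s ∩ t) * d' (s ∪ t))
    (hcd' : ∀ s t, c s * d' t ≤ c (s ∩ t) * d' (s ∪ t))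
    (hdd' : ∀ s t, d s * d' t ≤ d (s ∩ t) * d' (s ∪ t))
    (z : Finset V → R) (hz0 : ∀ W, 0 ≤ z W) (hzm : ∀ s t, z s ≤ z (s ∪ t)) :
    (∑ W ∈ U.powerset, ν W * chainMix ent ent' 0 c d W * z W) *
      (∑ W ∈ U.powerset.filter (fun W => ∃ r ∈ ent, r ∈ W), ν W * d' W) ≤
    (∑ W ∈ U.powerset, ν W * chainMix ent ent' 0 c d W) *
      (∑ W ∈ U.powerset.filter (fun W => ∃ r ∈ ent, r ∈ W), ν W * d' W * z W) := by
  have hm0 : ∀ W, 0 ≤ chainMix ent ent' 0 c d W :=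
    chainMix_nonneg ent ent' le_rfl zero_le_one hc0 hd0
  have hcross : ∀ s t, chainMix ent ent' 0 c d s * d' t ≤
      chainMix ent ent' 0 c d (s ∩ t) * d' (s ∪ t) := by
    intro s t
    have h := chain_cross_holley ent ent' 0 le_rfl zero_le_one c d d' hdc hcd' hdd' hd'0 t s
    rw [Finset.inter_comm, Finset.union_comm] at h
    linarith
  have h1 := mean_le_tilt U ν (chainMix ent ent' 0 c d) d' z hν0 hν hm0 hd'0 hcross hz0 hzm
  have h2 := tilt_upset_mean U ent ν d' z hν0 hν hd'0 hd'd' hz0 hzm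
  set mM := ∑ W ∈ U.powerset, ν W * chainMix ent ent' 0 c d W with hmM
  set zz := ∑ W ∈ U.powerset, ν W * chainMix ent ent' 0 c d W * z W with hzz
  set r := ∑ W ∈ U.powerset.filter (fun W => ∃ r ∈ ent, r ∈ W), ν W * d' W with hr
  set zr := ∑ W ∈ U.powerset.filter (fun W => ∃ r ∈ ent, r ∈ W), ν W * d' W * z W with hzr
  set D := ∑ W ∈ U.powerset, ν W * d' W with hDdef
  set Dz := ∑ W ∈ U.powerset, ν W * d' W * z W with hDzdef
  have hD0 : 0 ≤ D := Finset.sum_nonneg fun W _ => mul_nonneg (hν0 W) (hd'0 W)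
  have hr0 : 0 ≤ r := Finset.sum_nonneg fun W _ => mul_nonneg (hν0 W) (hd'0 W)
  have hmM0 : 0 ≤ mM := Finset.sum_nonneg fun W _ => mul_nonneg (hν0 W) (hm0 W)
  have hchain : D * (zz * r) ≤ D * (mM * zr) := by
    have e1 := mul_le_mul_of_nonneg_right h1 hr0
    have e2 := mul_le_mul_of_nonneg_left h2 hmM0
    calc D * (zz * r) = (zz * D) * r := by ring
      _ ≤ (mM * Dz) * r := e1
      _ = mM * (Dz * r) := by ring
      _ ≤ mM * (D * zr) := e2
      _ = D * (mM * zr) := by ring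
  rcases eq_or_lt_of_le hD0 with hDz | hDpos
  · have hterm : ∀ W ∈ U.powerset, ν W * d' W = 0 := by
      intro W hW
      exact (Finset.sum_eq_zero_iff_of_nonneg (fun W _ => mul_nonneg (hν0 W) (hd'0 W))).1
        hDz.symm W hW
    have hr_zero : r = 0 := by
      rw [hr]
      exact Finset.sum_eq_zero fun W hW => hterm W (Finset.mem_filter.1 hW).1
    have hzr_zero : zr = 0 := by
      rw [hzr]
      exact Finset.sum_eq_zero fun W hW => by rw [hterm W (Finset.mem_filter.1 hW).1, zero_mul]
    rw [hr_zero, hzr_zero]; simp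
  · exact le_of_mul_le_mul_left hchain hDpos

/-- **Nested ideals have increasing means**: for `I₀ = {W misses ent ∪ ent'} ⊆ I_e = {W misses ent}`
and the log-supermodular law `ν c`: `(∑_{I_e} ν c)·(∑_{I₀} ν c z) ≤ (∑_{I₀} ν c)·(∑_{I_e} ν c z)`. -/
theorem nested_ideal_mean (U ent ent' : Finset V) (ν c : Finset V → R)
    (hν0 : ∀ W, 0 ≤ ν W) (hν : ∀ s ⊆ U, ∀ t ⊆ U, ν s * ν t ≤ ν (s ∩ t) * ν (s ∪ t))
    (hc0 : ∀ W, 0 ≤ c W) (hcc : ∀ s t, c s * c t ≤ c (s ∩ t) * c (s ∪ t))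
    (z : Finset V → R) (hz0 : ∀ W, 0 ≤ z W) (hzm : ∀ s t, z s ≤ z (s ∪ t)) :
    (∑ W ∈ U.powerset.filter (fun W => ¬ ∃ r ∈ ent, r ∈ W), ν W * c W) *
        (∑ W ∈ U.powerset.filter (fun W => ¬ ∃ r ∈ ent ∪ ent', r ∈ W), ν W * c W * z W) ≤
      (∑ W ∈ U.powerset.filter (fun W => ¬ ∃ r ∈ ent ∪ ent', r ∈ W), ν W * c W) *
        (∑ W ∈ U.powerset.filter (fun W => ¬ ∃ r ∈ ent, r ∈ W), ν W * c W * z W) := by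
  simp only [Finset.sum_filter]
  have n₁ : ∀ W, (0 : R) ≤ (if ¬ ∃ r ∈ ent, r ∈ W then ν W * c W else 0) := fun W => by
    split_ifs <;> first | exact le_rfl | exact mul_nonneg (hν0 W) (hc0 W)
  have n₂ : ∀ W, (0 : R) ≤ (if ¬ ∃ r ∈ ent ∪ ent', r ∈ W then ν W * c W * z W else 0) :=
    fun W => by
    split_ifs <;> first | exact le_rfl | exact mul_nonneg (mul_nonneg (hν0 W) (hc0 W)) (hz0 W)
  have n₃ : ∀ W, (0 : R) ≤ (if ¬ ∃ r ∈ ent ∪ ent', r ∈ W then ν W * c W else 0) := fun W => by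
    split_ifs <;> first | exact le_rfl | exact mul_nonneg (hν0 W) (hc0 W)
  have n₄ : ∀ W, (0 : R) ≤ (if ¬ ∃ r ∈ ent, r ∈ W then ν W * c W * z W else 0) := fun W => by
    split_ifs <;> first | exact le_rfl | exact mul_nonneg (mul_nonneg (hν0 W) (hc0 W)) (hz0 W)
  refine ad_pointwise U _ _ _ _ n₁ n₂ n₃ n₄ ?_
  intro s hs t ht
  by_cases h1 : ¬ ∃ r ∈ ent, r ∈ s
  · by_cases h2 : ¬ ∃ r ∈ ent ∪ ent', r ∈ t
    · have h3 : ¬ ∃ r ∈ ent ∪ ent', r ∈ s ∩ t := by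
        rintro ⟨r, hr, hrst⟩
        exact h2 ⟨r, hr, (Finset.mem_inter.1 hrst).2⟩
      have h4 : ¬ ∃ r ∈ ent, r ∈ s ∪ t := by
        rintro ⟨r, hr, hrst⟩
        rcases Finset.mem_union.1 hrst with h | h
        · exact h1 ⟨r, hr, h⟩
        · exact h2 ⟨r, Finset.mem_union_left _ hr, h⟩
      rw [if_pos h1, if_pos h2, if_pos h3, if_pos h4]
      have hzt : z t ≤ z (s ∪ t) := by rw [Finset.union_comm]; exact hzm t s
      have hlsm : ν s * c s * (ν t * c t) ≤ ν (s ∩ t) * c (s ∩ t) * (ν (s ∪ t) * c (s ∪ t)) := by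
        calc ν s * c s * (ν t * c t) = (ν s * ν t) * (c s * c t) := by ring
          _ ≤ (ν (s ∩ t) * ν (s ∪ t)) * (c (s ∩ t) * c (s ∪ t)) :=
              mul_le_mul (hν s hs t ht) (hcc s t) (mul_nonneg (hc0 _) (hc0 _))
                (mul_nonneg (hν0 _) (hν0 _))
          _ = _ := by ring
      calc ν s * c s * (ν t * c t * z t) = (ν s * c s * (ν t * c t)) * z t := by ring
        _ ≤ (ν (s ∩ t) * c (s ∩ t) * (ν (s ∪ t) * c (s ∪ t))) * z (s ∪ t) :=
            mul_le_mul hlsm hzt (hz0 t)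
              (mul_nonneg (mul_nonneg (hν0 _) (hc0 _)) (mul_nonneg (hν0 _) (hc0 _)))
        _ = _ := by ring
    · rw [if_neg h2, mul_zero]
      exact mul_nonneg (n₃ _) (n₄ _)
  · rw [if_neg h1, zero_mul]
    exact mul_nonneg (n₃ _) (n₄ _)

end XASignsLemmas

section XASignsAlg

variable {R : Type*} [Field R] [LinearOrder R] [IsStrictOrderedRing R]

/-- **The algebra of the τ-layer-cake proof of (XA′).**  With the cleared shifts
`q̃_x = a1 b0 − a0 b1`, `p̃⁰_x = a1 e0 − a0 e1`, `q̃_y = a2 b0 − a0 b2`, `p̃⁰_y = a2 e0 − a0 e2` and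
`K = a1 g0 − a0 g1`: from the τ-layer-cake bound `hTL`, the ideal bound `hD`, the two killed
`y`-bounds `hβ`, `hα` (through the nested ideals `hnest`), the masses `m ≤ a0`, `m_e ≤ a0` and the
sign conditions, `Cross ≤ a0·U001`. -/
theorem xa_signs_alg (a0 a1 a2 b0 b1 b2 e0 e1 e2 g0 g1 g2 g12 m my me Ye : R)
    (ha0 : 0 ≤ a0) (hm0 : 0 ≤ m) (hmpos : 0 < m)
    (hTL : (a2 * m - a0 * my) * (a1 * g0 - a0 * g1) ≤
      m * (a0 * a0 * g12 - a0 * a2 * g1 - a0 * a1 * g2 + a1 * a2 * g0))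
    (hD : a0 * my ≤ a2 * m) (hm_le : m ≤ a0) (hme_le : me ≤ a0)
    (hβ : a2 * b0 - a0 * b2 ≤ a2 * m - a0 * my) (hα : a2 * e0 - a0 * e2 ≤ a2 * me - a0 * Ye)
    (hnest : me * my ≤ m * Ye)
    (hqx : a0 * b1 ≤ a1 * b0) (hp0x : a0 * e1 ≤ a1 * e0)
    (hK' : 0 ≤ (a0 * b1 - a1 * b0) - (a0 * g1 - a1 * g0) + (a0 * e1 - a1 * e0)) :
    (a0 * b1 - a1 * b0) * (a0 * e2 - a2 * e0) + (a0 * b2 - a2 * b0) * (a0 * e1 - a1 * e0) ≤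
      a0 * (a0 * a0 * g12 - a0 * a2 * g1 - a0 * a1 * g2 + a1 * a2 * g0) := by
  have hD0 : 0 ≤ a2 * m - a0 * my := by linarith
  have hβ' : m * (a2 * b0 - a0 * b2) ≤ a0 * (a2 * m - a0 * my) := by
    calc m * (a2 * b0 - a0 * b2) ≤ m * (a2 * m - a0 * my) := mul_le_mul_of_nonneg_left hβ hm0
      _ ≤ a0 * (a2 * m - a0 * my) := mul_le_mul_of_nonneg_right hm_le hD0
  have hα' : m * (a2 * e0 - a0 * e2) ≤ a0 * (a2 * m - a0 * my) := by
    have h1 : m * (a2 * e0 - a0 * e2) ≤ m * (a2 * me - a0 * Ye) := mul_le_mul_of_nonneg_left hα hm0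
    have h2 : a0 * (me * my) ≤ a0 * (m * Ye) := mul_le_mul_of_nonneg_left hnest ha0
    have h3 : me * (a2 * m - a0 * my) ≤ a0 * (a2 * m - a0 * my) :=
      mul_le_mul_of_nonneg_right hme_le hD0
    nlinarith [h1, h2, h3]
  have hqx' : 0 ≤ a1 * b0 - a0 * b1 := by linarith
  have hp0x' : 0 ≤ a1 * e0 - a0 * e1 := by linarith
  have hKK : a1 * b0 - a0 * b1 + (a1 * e0 - a0 * e1) ≤ a1 * g0 - a0 * g1 := by linarith
  have h1 : a0 * ((a2 * m - a0 * my) * (a1 * g0 - a0 * g1)) ≤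
      a0 * (m * (a0 * a0 * g12 - a0 * a2 * g1 - a0 * a1 * g2 + a1 * a2 * g0)) :=
    mul_le_mul_of_nonneg_left hTL ha0
  have h2 : a0 * (a2 * m - a0 * my) * (a1 * b0 - a0 * b1 + (a1 * e0 - a0 * e1)) ≤
      a0 * (a2 * m - a0 * my) * (a1 * g0 - a0 * g1) :=
    mul_le_mul_of_nonneg_left hKK (mul_nonneg ha0 hD0)
  have h3 : (a1 * b0 - a0 * b1) * (m * (a2 * e0 - a0 * e2)) ≤
      (a1 * b0 - a0 * b1) * (a0 * (a2 * m - a0 * my)) :=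
    mul_le_mul_of_nonneg_left hα' hqx'
  have h4 : (a1 * e0 - a0 * e1) * (m * (a2 * b0 - a0 * b2)) ≤
      (a1 * e0 - a0 * e1) * (a0 * (a2 * m - a0 * my)) :=
    mul_le_mul_of_nonneg_left hβ' hp0x'
  have hmain : m * ((a0 * b1 - a1 * b0) * (a0 * e2 - a2 * e0) +
      (a0 * b2 - a2 * b0) * (a0 * e1 - a1 * e0)) ≤
      m * (a0 * (a0 * a0 * g12 - a0 * a2 * g1 - a0 * a1 * g2 + a1 * a2 * g0)) := by
    nlinarith [h1, h2, h3, h4]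
  exact le_of_mul_le_mul_left hmain hmpos

end XASignsAlg

end Summit.Ventures.PercRepro2.Coin
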